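import Summits.BirchSwinnertonDyer.BirchSwinnertonDyer.Theorems.ErratumRoadFiveBoundedCongruenceLimit
import HarnessLib

/-!
# Route `ErratumRoadFive` (K2), crux (T) `Rest3TorsionBranchAtFive` (item stmt-BirchSwinnertonDyer-19702):
# the Fitting-ideal inequality for an extension, `Fitt₀(K)·Fitt₀(Q) ⊆ Fitt₀(A)` for `K → A ↠ Q` exact
# (Stacks 07ZA (4), `k = l = 0`), and `d^n ∈ Fitt₀(K)` for `d ∈ Ann(K)`, `K` `n`-generated — the two
# algebra facts that turn «the control defect is finite of bounded order and exponent» (memo §31.2)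
# into the defect binder `hD` of `BoundedCongruenceLimit.mul_fittingIdeal_le_span_of_congruences`
# (p457703)

Cell `bsd-stepL` (run/shared/lean/pub/bsd-stepL/), seat `bsd-stepL-bdp` (prover g13, 2026-08-26), memo
`HOME/proof/PROOF-BDP.md` §31.3 (2); `--supports stmt-BirchSwinnertonDyer-19702 --as helper`.

HONEST FRAMING: PURE COMMUTATIVE ALGEBRA over an arbitrary commutative ring (theorems only; no
definition, no named fact, no `sorry`); nothing about Selmer groups or `p`-adic `L`-functions is asserted;
nothing is booked; no census word, tier or label moves (T7).

## What

* `pow_mem_fittingIdeal_zero_of_mem_annihilator` — if `M` is generated by `n` elements and `d` kills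
  `M`, then `d ^ n ∈ Fitt₀(M)` (the diagonal relation matrix `d·1ₙ`; Stacks 07ZA (2) in the form used).
* `fittingIdeal_zero_mul_le_of_exact` — for `R`-linear `f : K → A`, `g : A → Q` with `range f = ker g`
  and `g` surjective (`K`, `Q` finite): `Fitt₀(K)·Fitt₀(Q) ⊆ Fitt₀(A)` (Stacks 07ZA (4) with `k = l = 0`).
  Proof (Eisenbud §20.2 ∕ Stacks): generate `A` by lifts `x̃` of generators `x` of `Q` followed by the
  images `f κ` of generators `κ` of `K`; a square relation matrix `ρ_Q` of `x` lifts to relations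
  `(ρ_Q | −c)` of `(x̃, fκ)` (the defect `∑ ρ_Q x̃ ∈ ker g = f(K)` written on `κ`), a square relation
  matrix `ρ_K` of `κ` gives relations `(0 | ρ_K)`; the resulting block-triangular minor has determinant
  `det ρ_Q · det ρ_K` (`Matrix.det_fromBlocks_zero₂₁`).
* `span_pow_mul_fittingIdeal_zero_le_of_exact` — the shape consumed by §31.3 (2): if moreover `K` is
  generated by `n` elements and killed by `d`, then `(d^n)·Fitt₀(Q) ⊆ Fitt₀(A)`; with
  `A = N_m/I^mN_m`, `Q = Q_m` and `BoundedCongruenceLimit.defect_le_sup_of_le_quotient` this is the binder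
  `hD` (`D = (d^n)`, `d = p^k`, `n = c₀`).

References: [StacksProject] Tag 07ZA (2), (4); [Eisenbud1995] §20.2, Cor. 20.4; tree
`Literature/RingTheory/FittingIdeal/{Basic,FittingLemma,Functoriality}.lean` (`Module.relMinorIdeal`,
Fitting's lemma `Module.fittingIdeal_eq_relMinorIdeal`).
-/

set_option autoImplicit false
-- the Theorems namespace of this sub repeats the summit name by design (D-0017 nested layout)
set_option linter.dupNamespace false

noncomputable section

open Literature.RingTheory.FittingIdeal

namespace Summit.BirchSwinnertonDyer.BirchSwinnertonDyer.Theorems.FittingExtension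

universe u v w w'

variable {R : Type u} [CommRing R]

/-! ### §1 `d^n ∈ Fitt₀(M)` for an `n`-generated module killed by `d` -/

/-- **`d^n ∈ Fitt₀(M)`** if `x₁, …, xₙ` generate `M` and `d ∈ Ann(M)`: the diagonal matrix `d·1ₙ` is a
relation matrix among the `xᵢ`, and its determinant is `d^n` (Stacks 07ZA (2): `Ann(M)^n ⊆ Fitt₀(M)`,
in the form used). [cite: StacksProject, Tag 07ZA (2)] -/
theorem pow_mem_fittingIdeal_zero_of_span_eq_top {M : Type v} [AddCommGroup M] [Module R M] {n : ℕ}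
    (x : Fin n → M) (hx : Submodule.span R (Set.range x) = ⊤) {d : R}
    (hd : ∀ m : M, d • m = 0) : d ^ n ∈ Module.fittingIdeal R M 0 := by
  classical
  rw [Module.fittingIdeal_eq_relMinorIdeal x hx 0, Nat.sub_zero]
  have h := Module.det_mem_relMinorIdeal (R := R) x
    (fun i l => (Matrix.diagonal fun _ : Fin n => d) i l)
    (fun i => by simp [Matrix.diagonal_apply, ite_smul, hd]) id
  have hmat : (Matrix.of fun i i' : Fin n => (Matrix.diagonal fun _ : Fin n => d) i (id i')) =
      Matrix.diagonal (fun _ : Fin n => d) := by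
    ext i i'; rfl
  rwa [hmat, Matrix.det_diagonal, Finset.prod_const, Finset.card_univ, Fintype.card_fin] at h

/-- **`d^n ∈ Fitt₀(M)`** for a module generated by `n` elements (some generating family of size `n`) and
killed by `d`. [cite: StacksProject, Tag 07ZA (2)] -/
theorem pow_mem_fittingIdeal_zero_of_mem_annihilator {M : Type v} [AddCommGroup M] [Module R M] {n : ℕ}
    (hgen : ∃ x : Fin n → M, Submodule.span R (Set.range x) = ⊤) {d : R}
    (hd : d ∈ Module.annihilator R M) : d ^ n ∈ Module.fittingIdeal R M 0 := by
  obtain ⟨x, hx⟩ := hgen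
  exact pow_mem_fittingIdeal_zero_of_span_eq_top x hx fun m => Module.mem_annihilator.mp hd m

/-! ### §2 `Fitt₀(K)·Fitt₀(Q) ⊆ Fitt₀(A)` for `K → A ↠ Q` exact -/

section Extension

variable {K : Type v} {A : Type w} {Q : Type w'} [AddCommGroup K] [Module R K] [AddCommGroup A]
  [Module R A] [AddCommGroup Q] [Module R Q]

/-- The combined family: lifts of the generators of `Q`, then the images of the generators of `K`,
generates `A`. [cite: Eisenbud1995, §20.2] -/
theorem span_append_eq_top (f : K →ₗ[R] A) (g : A →ₗ[R] Q) (hfg : Function.Exact f g)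
    {n r : ℕ} (x : Fin n → Q) (hx : Submodule.span R (Set.range x) = ⊤)
    (κ : Fin r → K) (hκ : Submodule.span R (Set.range κ) = ⊤)
    (xt : Fin n → A) (hxt : ∀ l, g (xt l) = x l) :
    Submodule.span R (Set.range (Fin.append xt (fun t => f (κ t)))) = ⊤ := by
  rw [Submodule.eq_top_iff']
  intro a
  -- write `g a` on the generators of `Q`
  obtain ⟨c, hc⟩ := (Submodule.mem_span_range_iff_exists_fun R).mp
    (show g a ∈ Submodule.span R (Set.range x) by rw [hx]; exact Submodule.mem_top)
  -- the defect lies in `ker g = range f`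
  have hker : g (a - ∑ i, c i • xt i) = 0 := by
    simp only [map_sub, map_sum, map_smul, hxt, hc, sub_self]
  obtain ⟨k, hk⟩ := (hfg _).mp hker
  obtain ⟨e, he⟩ := (Submodule.mem_span_range_iff_exists_fun R).mp
    (show k ∈ Submodule.span R (Set.range κ) by rw [hκ]; exact Submodule.mem_top)
  have ha : a = ∑ i, c i • xt i + ∑ t, e t • f (κ t) := by
    have : ∑ t, e t • f (κ t) = f k := by
      rw [← he]; simp only [map_sum, map_smul]
    rw [this, hk]; abel
  rw [ha]
  refine Submodule.add_mem _ (Submodule.sum_mem _ fun i _ => Submodule.smul_mem _ _ ?_)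
    (Submodule.sum_mem _ fun t _ => Submodule.smul_mem _ _ ?_)
  · exact Submodule.subset_span ⟨Fin.castAdd r i, Fin.append_left _ _ i⟩
  · exact Submodule.subset_span ⟨Fin.natAdd n t, Fin.append_right _ _ t⟩

/-- **Stacks 07ZA (4) for `k = l = 0`: `Fitt₀(K)·Fitt₀(Q) ⊆ Fitt₀(A)`** whenever `K —f→ A —g→ Q → 0`
is exact (`range f = ker g`, `g` onto; `f` need not be injective) and `K`, `Q` are finite. Proof: with
`A` generated by `(x̃, fκ)` as in `span_append_eq_top`, a square relation matrix `ρ_Q` among the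
generators `x` of `Q` lifts to relations `(ρ_Q | −c)` among `(x̃, fκ)`, a square relation matrix `ρ_K`
among `κ` gives relations `(0 | ρ_K)`; for any column choices the resulting `(n+r) × (n+r)` minor is
block upper-triangular with determinant `det(ρ_Q-minor)·det(ρ_K-minor)`; by Fitting's lemma these
products generate `Fitt₀(Q)·Fitt₀(K)`. [cite: StacksProject, Tag 07ZA (4)] [cite: Eisenbud1995, §20.2] -/
theorem fittingIdeal_zero_mul_le_of_exact [Module.Finite R K] [Module.Finite R Q]
    (f : K →ₗ[R] A) (g : A →ₗ[R] Q) (hfg : Function.Exact f g) (hg : Function.Surjective g) :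
    Module.fittingIdeal R K 0 * Module.fittingIdeal R Q 0 ≤ Module.fittingIdeal R A 0 := by
  classical
  obtain ⟨n, x, hx⟩ := Module.Finite.exists_fin (R := R) (M := Q)
  obtain ⟨r, κ, hκ⟩ := Module.Finite.exists_fin (R := R) (M := K)
  -- lifts of the generators of `Q`
  choose xt hxt using fun l => hg (x l)
  -- the generating family of `A`
  set y : Fin (n + r) → A := Fin.append xt (fun t => f (κ t)) with hy_def
  have hy : Submodule.span R (Set.range y) = ⊤ := span_append_eq_top f g hfg x hx κ hκ xt hxt
  rw [Module.fittingIdeal_eq_relMinorIdeal κ hκ 0, Module.fittingIdeal_eq_relMinorIdeal x hx 0,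
    Module.fittingIdeal_eq_relMinorIdeal y hy 0, Nat.sub_zero, Nat.sub_zero, Nat.sub_zero]
  -- reduce to generators of the two minors ideals
  rw [Module.relMinorIdeal, Module.relMinorIdeal, Ideal.span_mul_span']
  refine Ideal.span_le.mpr ?_
  rintro _ ⟨dK, ⟨ρK, σK, hρK, rfl⟩, dQ, ⟨ρQ, σQ, hρQ, rfl⟩, rfl⟩
  -- each `∑ ρQ i l • x̃ l` lies in `ker g = range f`; write it on `κ`
  have hkerQ : ∀ i, g (∑ l, ρQ i l • xt l) = 0 := fun i => by
    simp only [map_sum, map_smul, hxt, hρQ i]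
  choose k hk using fun i => (hfg _).mp (hkerQ i)
  choose c hc using fun i => (Submodule.mem_span_range_iff_exists_fun R).mp
    (show k i ∈ Submodule.span R (Set.range κ) by rw [hκ]; exact Submodule.mem_top)
  -- the relations among `y`
  let P : Fin (n + r) → Fin (n + r) → R :=
    Fin.append (fun i => Fin.append (ρQ i) (fun t => -c i t)) (fun b => Fin.append 0 (ρK b))
  have hP : ∀ i, ∑ l, P i l • y l = 0 := by
    intro i
    refine Fin.addCases (fun a => ?_) (fun b => ?_) i
    · simp only [P, hy_def, Fin.append_left, Fin.sum_univ_add, Fin.append_right]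
      have h1 : ∑ t, (-c a t) • f (κ t) = -f (k a) := by
        rw [← hc a]
        simp only [map_sum, map_smul, neg_smul, Finset.sum_neg_distrib]
      rw [h1, hk a, add_neg_cancel]
    · simp only [P, hy_def, Fin.append_right, Fin.sum_univ_add, Fin.append_left, Pi.zero_apply,
        zero_smul, Finset.sum_const_zero, zero_add]
      have h2 : ∑ t, ρK b t • f (κ t) = f (∑ t, ρK b t • κ t) := by
        simp only [map_sum, map_smul]
      rw [h2, hρK b, map_zero]
  -- the column choice
  let τ : Fin (n + r) → Fin (n + r) := Fin.append (fun a' => Fin.castAdd r (σQ a')) (fun b' => Fin.natAdd n (σK b'))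
  have hmem := Module.det_mem_relMinorIdeal y P hP τ
  -- the minor is block upper-triangular
  have hblock : (Matrix.of fun i i' => P i (τ i')) =
      Matrix.reindex finSumFinEquiv finSumFinEquiv
        (Matrix.fromBlocks (Matrix.of fun a a' => ρQ a (σQ a'))
          (Matrix.of fun a b' => -c a (σK b')) 0 (Matrix.of fun b b' => ρK b (σK b'))) := by
    ext i i'
    simp only [Matrix.reindex_apply, Matrix.submatrix_apply, Matrix.of_apply]
    refine Fin.addCases (fun a => ?_) (fun b => ?_) i <;>
      refine Fin.addCases (fun a' => ?_) (fun b' => ?_) i'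
    · simp [P, τ, finSumFinEquiv_symm_apply_castAdd, Fin.append_left]
    · simp [P, τ, finSumFinEquiv_symm_apply_castAdd, finSumFinEquiv_symm_apply_natAdd,
        Fin.append_left, Fin.append_right]
    · simp [P, τ, finSumFinEquiv_symm_apply_castAdd, finSumFinEquiv_symm_apply_natAdd,
        Fin.append_left, Fin.append_right]
    · simp [P, τ, finSumFinEquiv_symm_apply_natAdd, Fin.append_right]
  rw [hblock, Matrix.det_reindex_self, Matrix.det_fromBlocks_zero₂₁] at hmem
  show (Matrix.of fun i i' => ρK i (σK i')).det * (Matrix.of fun i i' => ρQ i (σQ i')).det ∈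
    Module.relMinorIdeal R y (n + r)
  rw [mul_comm]
  exact hmem

/-- **The shape consumed by memo §31.3 (2).** If `K —f→ A —g→ Q → 0` is exact with `g` onto, `K` is
generated by `n` elements and killed by `d`, then `(d^n)·Fitt₀(Q) ⊆ Fitt₀(A)`. With `A = N_m/I^mN_m`
(`N_m = X^Σ_ac(A_{g_m})`), `Q = Q_m` (the dual residual Selmer group), `K` the control defect (finite
of order `≤ p^{c₀}`, exponent `p^k`: `n = c₀`, `d = p^k`) and
`BoundedCongruenceLimit.defect_le_sup_of_le_quotient`, this is the binder `hD` of
`BoundedCongruenceLimit.mul_fittingIdeal_le_span_of_congruences` (p457703) with `D = (p^{k c₀})`.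
[cite: StacksProject, Tag 07ZA (2), (4)] -/
theorem span_pow_mul_fittingIdeal_zero_le_of_exact [Module.Finite R Q]
    (f : K →ₗ[R] A) (g : A →ₗ[R] Q) (hfg : Function.Exact f g) (hg : Function.Surjective g)
    {n : ℕ} (hgen : ∃ κ : Fin n → K, Submodule.span R (Set.range κ) = ⊤) {d : R}
    (hd : d ∈ Module.annihilator R K) :
    Ideal.span {d ^ n} * Module.fittingIdeal R Q 0 ≤ Module.fittingIdeal R A 0 := by
  haveI : Module.Finite R K := by
    obtain ⟨κ, hκ⟩ := hgen
    exact ⟨by rw [← hκ]; exact Submodule.fg_span (Set.finite_range κ)⟩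
  calc Ideal.span {d ^ n} * Module.fittingIdeal R Q 0
      ≤ Module.fittingIdeal R K 0 * Module.fittingIdeal R Q 0 :=
        Ideal.mul_mono_left ((Ideal.span_singleton_le_iff_mem _).mpr
          (pow_mem_fittingIdeal_zero_of_mem_annihilator hgen hd))
    _ ≤ Module.fittingIdeal R A 0 := fittingIdeal_zero_mul_le_of_exact f g hfg hg

end Extension

end Summit.BirchSwinnertonDyer.BirchSwinnertonDyer.Theorems.FittingExtension

end
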